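import Mathlib
import Summits.Ventures.PercRepro.TriangleCapUniform
import Summits.Ventures.PercRepro.TriangleCapStarPlus
import Summits.Ventures.PercRepro.TriangleCapStarPlusTwo
import Summits.Ventures.PercRepro.TriangleCapStarPlusThree
import Summits.Ventures.PercRepro.TriangleCapSixNine

/-!
# PercRepro — THE `K₄⁻`-FREE CHERRY TABLE ON EVERY CELL `k ≥ t + 3`, FOR EVERY `t ≥ 1` (p3, gen 33; part 26)

One statement for the whole table outside the dense corner `k ≤ t + 2`: for every `t ≥ 1` and every `k ≥ t + 3`
the maximum of `Σ_v C(d(v), 2)` over `K₄⁻`-free graphs with `k − 1 + t` edges on `k` vertices is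
`max (C(k − 1, 2) + 2t) (C(k − 2, 2) + C(t + 1, 2) + t + 1)` — the star plus `t` disjoint leaf edges against
`K_{2,t+1}` plus `k − t − 3` pendant edges, the larger one winning (`table_exact_all`).  The rows `t ≤ 4` are the
modules TriangleCapStarPlus (`t = 1`, every graph), TriangleCapStarPlusTwo (`t = 2`), TriangleCapStarPlusThree
with the tie `(6, 8) = 16 = K_{2,4}` (`t = 3`), TriangleCapSixNine's `row_plus_three_all` with the cells
`(7, 10) = 25`, `(8, 11) = 30` (`t = 4`); the rows `t ≥ 5` are TriangleCapUniform's `table_exact`.  Axioms: standard.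
-/

namespace PercRepro

namespace TriangleCap

namespace C047

open Finset

/-- **THE `K₄⁻`-FREE CHERRY TABLE, EVERY CELL `k ≥ t + 3`, EVERY `t ≥ 1`:** the maximum of `Σ_v C(d(v), 2)` over
`K₄⁻`-free graphs with `k − 1 + t` edges on `k` vertices is `max (C(k − 1, 2) + 2t) (C(k − 2, 2) + C(t + 1, 2) + t + 1)`. -/
theorem table_exact_all (t k : ℕ) (ht : 1 ≤ t) (hk3 : t + 3 ≤ k) :
    (∀ (D : SimpleGraph (Fin k)) [DecidableRel D.Adj], K4mFree D → D.edgeFinset.card + 1 = k + t →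
        cherries D ≤ max ((k - 1).choose 2 + 2 * t) ((k - 2).choose 2 + (t + 1).choose 2 + t + 1)) ∧
      ∃ (D : SimpleGraph (Fin k)) (_ : DecidableRel D.Adj),
        K4mFree D ∧ D.edgeFinset.card + 1 = k + t ∧
          cherries D = max ((k - 1).choose 2 + 2 * t) ((k - 2).choose 2 + (t + 1).choose 2 + t + 1) := by
  rcases (by omega : t = 1 ∨ t = 2 ∨ t = 3 ∨ t = 4 ∨ 5 ≤ t) with rfl | rfl | rfl | rfl | h5
  · -- `t = 1`: the diagonal `m = k`, the star value on every graph
    rw [max_eq_left (bipPend_value_le_star 1 k hk3 (by omega))]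
    obtain ⟨h1, D, inst, hK, hD, hc⟩ := diagonal_rows_exact k (by omega)
    refine ⟨fun D _ hK hD => ?_, D, inst, hK, by omega, by omega⟩
    have := h1 D hK (by omega)
    omega
  · -- `t = 2`: the row `m = k + 1`
    rw [max_eq_left (bipPend_value_le_star 2 k hk3 (by omega))]
    obtain ⟨h1, D, inst, hK, hD, hc⟩ := row_plus_one_exact k (by omega)
    refine ⟨fun D _ hK hD => ?_, D, inst, hK, by omega, by omega⟩
    have := h1 D hK (by omega)
    omega
  · -- `t = 3`: the row `m = k + 2`, the tie `(6, 8)` with `K_{2,4}`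
    rw [max_eq_left (bipPend_value_le_star 3 k hk3 (by omega))]
    refine ⟨fun D _ hK hD => ?_, ?_⟩
    · have := cherries_le_choose_two_add_six_of_k4mFree D hK (by rw [Fintype.card_fin]; omega)
        (by rw [Fintype.card_fin]; omega)
      simpa using this
    · rcases (by omega : k = 6 ∨ 7 ≤ k) with rfl | h7
      · refine ⟨bipPend 6 3, inferInstance, k4mFree_bipPend 6 3, card_edges_bipPend 6 3 (by norm_num), ?_⟩
        rw [cherries_bipPend 6 3 (by norm_num)]
        decide
      · obtain ⟨D, inst, hK, hD, hc⟩ := exists_k4mFree_row_plus_two k h7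
        exact ⟨D, inst, hK, by omega, by omega⟩
  · -- `t = 4`: the row `m = k + 3` with the cells `(7, 10) = 25` and `(8, 11) = 30`
    obtain ⟨h1, D, inst, hK, hD, hc⟩ := row_plus_three_all k (by omega)
    have hval : (k - 1).choose 2 + 8 + (if k = 7 then 2 else if k = 8 then 1 else 0) =
        max ((k - 1).choose 2 + 2 * 4) ((k - 2).choose 2 + (4 + 1).choose 2 + 4 + 1) := by
      rcases (by omega : k = 7 ∨ k = 8 ∨ 9 ≤ k) with rfl | rfl | h9
      · decide
      · decide
      · rw [if_neg (by omega), if_neg (by omega), max_eq_left (bipPend_value_le_star 4 k hk3 (by omega))]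
    refine ⟨fun D _ hK hD => ?_, D, inst, hK, by omega, by rw [hc, hval]⟩
    rw [← hval]
    exact h1 D hK (by omega)
  · exact table_exact t k h5 hk3

/-- The cells of the `k ≤ 9` census with `k ≥ t + 3`, read off the theorem: `(5, 5) 8 · (6, 8) 16 · (7, 10) 25 ·
(8, 11) 30 · (8, 12) 36 · (9, 12) 36 · (9, 13) 42 · (9, 14) 49`. -/
theorem table_values :
    max ((5 - 1).choose 2 + 2 * 1) ((5 - 2).choose 2 + (1 + 1).choose 2 + 1 + 1) = 8 ∧
      max ((6 - 1).choose 2 + 2 * 3) ((6 - 2).choose 2 + (3 + 1).choose 2 + 3 + 1) = 16 ∧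
      max ((7 - 1).choose 2 + 2 * 4) ((7 - 2).choose 2 + (4 + 1).choose 2 + 4 + 1) = 25 ∧
      max ((8 - 1).choose 2 + 2 * 4) ((8 - 2).choose 2 + (4 + 1).choose 2 + 4 + 1) = 30 ∧
      max ((8 - 1).choose 2 + 2 * 5) ((8 - 2).choose 2 + (5 + 1).choose 2 + 5 + 1) = 36 ∧
      max ((9 - 1).choose 2 + 2 * 4) ((9 - 2).choose 2 + (4 + 1).choose 2 + 4 + 1) = 36 ∧
      max ((9 - 1).choose 2 + 2 * 5) ((9 - 2).choose 2 + (5 + 1).choose 2 + 5 + 1) = 42 ∧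
      max ((9 - 1).choose 2 + 2 * 6) ((9 - 2).choose 2 + (6 + 1).choose 2 + 6 + 1) = 49 := by
  decide

end C047

end TriangleCap

end PercRepro
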